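import Summits.NavierStokesRegularity.FluidComputer.RowStages
import HarnessLib

/-!
# Real views of the row check's integers; soundness of `I + hBE ≤ E`, `η`, `η'`
# (`pub-fluidc-bp3/R1-DESIGN.md` §9.2 / §9.4, layer B of `structure Row`)

HONEST FRAMING (cell `pub-fluidc`, blueprint seat bp3, gen 20): low prior, high value-of-information
experiment on Tao's machine paradigm; NOT a claim that NS blows up. Real / integer bookkeeping only.

Every integer `x` produced by the row check (`RowPipeline`, named stages in `RowStages`) stands
for the real number `x / 2^P`. This file proves, from the Boolean checks `hOK`, `eOK`, `chOK`,
`wOK` of `rowCheck` and `signsOK` (`RowStages`), the first "chain" hypotheses of `RowModel.Cert`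
for the real views
`ER, BR, hR, cR, etaR, etapR, phiR, AdR n, bdR n, AnR n, bnR n, ubR j, WbarR` (all defined here):
`hh` (`0 < h`, and `h = H/2^S` exactly), `hc`, `hB0`, `hφ0`, `hE0`, `hIE` (`I + hBE ≤ E`),
`hη` (`e^{-ch} ≤ η`, via `e^{-x} ≤ 1/(1+x)` and the floor `⌊ch⌋`), `hη'` (`e^{ch} ≤ η'`, via
`e^{x} ≤ 1/(1-x)` and the ceiling `⌈ch⌉ < 1`), plus the rounding lemma
`toR x · toR y ≤ toR ⌈xy/2^P⌉`. The squaring chains and blocks follow in `RowChainSound`; the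
enclosure half (`hF`, `hQ`, `hDB`, `hKB`, `hCF`, `hAPm`, `hEbar`, …) is the business of
`RowDefectSound` and the successor files.

[cite: Tao2016AveragedNS, §5.5 Thm 5.3 (5.5)]
-/

namespace Summit.NavierStokesRegularity.FluidComputer

open Literature.Analysis.FluidPDE.FluidComputer
open Literature.Analysis.ValidatedNumerics.Numerics (cdiv div_le_cdiv le_cdiv_mul_real)

namespace RowCheck

open DIVec ChainField Finset Real

namespace RowData

variable (r : RowData)

/-! ### Real views of the integer tables -/

/-- The real number an integer of the row stands for. [folklore] -/
noncomputable def toR (x : ℤ) : ℝ := (x : ℝ) / 2 ^ r.P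
/-- `E / 2^P`. [folklore] -/
noncomputable def ER (i k : Fin 8) : ℝ := r.toR (r.E i k)
/-- `B / 2^P`. [folklore] -/
noncomputable def BR (i j : Fin 8) : ℝ := r.toR (r.B'.at i j)
/-- the substep `h`. [folklore] -/
noncomputable def hR : ℝ := r.toR r.hInt'
/-- the shift `c`. [folklore] -/
noncomputable def cR : ℝ := r.toR r.c'
/-- `η`. [folklore] -/
noncomputable def etaR : ℝ := r.toR r.eta'
/-- `η'`. [folklore] -/
noncomputable def etapR : ℝ := r.toR r.etap'
/-- `φ`. [folklore] -/
noncomputable def phiR (i : Fin 8) : ℝ := r.toR (r.phi'.get i)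
/-- decayed chain matrix after `n` squarings. [folklore] -/
noncomputable def AdR (n : ℕ) (i k : Fin 8) : ℝ := r.toR ((r.dec n).1.at i k)
/-- decayed chain vector after `n` squarings. [folklore] -/
noncomputable def bdR (n : ℕ) (i : Fin 8) : ℝ := r.toR ((r.dec n).2.get i)
/-- no-decay chain matrix after `n` squarings. [folklore] -/
noncomputable def AnR (n : ℕ) (i k : Fin 8) : ℝ := r.toR ((r.nd n).1.at i k)
/-- no-decay chain vector after `n` squarings. [folklore] -/
noncomputable def bnR (n : ℕ) (i : Fin 8) : ℝ := r.toR ((r.nd n).2.get i)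
/-- node-value bound after `j` blocks. [folklore] -/
noncomputable def ubR (j : ℕ) (i : Fin 8) : ℝ := r.toR ((r.us j).1.get i)
/-- `W̄` of the non-phase components. [folklore] -/
noncomputable def WbarR (i : Fin 8) : ℝ := r.toR (r.Wbar i.succ)

variable {r}

/-- `2^P > 0`. [folklore] -/
private theorem twoP_pos (r : RowData) : (0 : ℝ) < 2 ^ r.P := by positivity

/-- `toR` is strictly monotone. [folklore] -/
theorem toR_lt {x y : ℤ} (h : x < y) : r.toR x < r.toR y :=
  div_lt_div_of_pos_right (by exact_mod_cast h) (twoP_pos r)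

/-- `toR` is monotone. [folklore] -/
theorem toR_mono {x y : ℤ} (h : x ≤ y) : r.toR x ≤ r.toR y :=
  div_le_div_of_nonneg_right (by exact_mod_cast h) (twoP_pos r).le

/-- `toR` of a nonnegative integer is nonnegative. [folklore] -/
theorem toR_nonneg {x : ℤ} (h : 0 ≤ x) : 0 ≤ r.toR x :=
  div_nonneg (by exact_mod_cast h) (twoP_pos r).le

/-- `toR` is additive. [folklore] -/
theorem toR_add (x y : ℤ) : r.toR (x + y) = r.toR x + r.toR y := by
  simp [toR, add_div]

/-- Rounded-up product: `toR x * toR y ≤ toR (cdiv (x*y) 2^P)`. [folklore] -/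
theorem toR_mul_le (x y : ℤ) : r.toR x * r.toR y ≤ r.toR (cdiv (x * y) (one r.P)) := by
  have h := div_le_cdiv_one r.P (x * y)
  push_cast at h
  have e : r.toR x * r.toR y = ((x : ℝ) * y / 2 ^ r.P) / 2 ^ r.P := by simp [toR]; ring
  rw [e]
  exact div_le_div_of_nonneg_right h (twoP_pos r).le

/-- Rounded-up matrix product in the `toR` view. [folklore] -/
theorem toR_mmUp (A B : Tab ℤ 8 8) (i k : Fin 8) :
    ∑ j, r.toR (A.at i j) * r.toR (B.at j k) ≤ r.toR ((mmUp r.P A B).at i k) :=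
  mmUp_ge r.P A B i k

/-- Rounded-up matrix-vector product in the `toR` view. [folklore] -/
theorem toR_mvUp (A : Tab ℤ 8 8) (v : Vec ℤ 8) (i : Fin 8) :
    ∑ j, r.toR (A.at i j) * r.toR (v.get j) ≤ r.toR ((mvUp r.P A v).get i) :=
  mvUp_ge r.P A v i

/-! ### The Boolean checks, unpacked -/

/-- What `signsOK` says. [folklore] -/
theorem nnOK_iff : r.signsOK = true ↔
    (∀ i k : Fin 8, 0 ≤ r.E i k) ∧ (∀ k : Fin 9, 0 ≤ r.Eb k) ∧ (∀ i : Fin 8, 0 ≤ r.u i.succ) ∧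
      (∀ k : Fin 9, 0 ≤ r.DEL k) ∧ (∀ i : Fin 8, 0 ≤ r.phi'.get i) ∧ 0 ≤ r.ph'.rho ∧ 0 < r.Hq := by
  simp only [signsOK, Bool.and_eq_true, decide_eq_true_eq, and_assoc]

/-- What `eOK` says. [folklore] -/
theorem eOK_iff : r.rowCheck.eOK = true ↔
    ∀ i k : Fin 8, (if i = k then one r.P * one r.P * one r.P else 0) +
      r.hInt' * (sumZ 8 fun j => r.B'.at i j * r.Et.at j k) ≤ r.Et.at i k * one r.P * one r.P := by
  rw [rowCheck_eq]; simp only [decide_eq_true_eq]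

/-- What `chOK` says. [folklore] -/
theorem chOK_iff : r.rowCheck.chOK = true ↔ r.ch' < one r.P := by
  rw [rowCheck_eq]; simp only [decide_eq_true_eq]

/-- What `hOK` says. [folklore] -/
theorem hOK_iff : r.rowCheck.hOK = true ↔ r.hq'.den = 1 := by
  rw [rowCheck_eq]; simp only [decide_eq_true_eq]

/-- What `wOK` says. [folklore] -/
theorem wOK_iff :
    r.rowCheck.wOK = true ↔ ∀ i : Fin 8, (r.us (2 ^ r.msub)).2.get i < r.Wbar i.succ := by
  rw [rowCheck_eq]; simp only [decide_eq_true_eq]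

/-! ### `h`, `c`, signs -/

/-- With `hOK`, the integer `hInt` is exactly `h·2^P`, i.e. `hR = H / 2^S`. [folklore] -/
theorem hR_eq (h : r.rowCheck.hOK = true) : r.hR = (r.Hq : ℝ) / 2 ^ r.S := by
  rw [hOK_iff] at h
  have e : (r.hInt' : ℚ) = r.hq' := by
    rw [hInt']; exact_mod_cast Rat.coe_int_num_of_den_eq_one h
  have e' : (r.hInt' : ℝ) = ((r.hq' : ℚ) : ℝ) := by exact_mod_cast congrArg (fun q : ℚ => (q : ℝ)) e
  rw [hR, toR, e', hq']
  push_cast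
  field_simp

/-- `0 < h` (`Cert.hh`). [folklore] -/
theorem hR_pos (h : r.rowCheck.hOK = true) (hn : r.signsOK = true) : 0 < r.hR := by
  rw [hR_eq h]
  have := (nnOK_iff.mp hn).2.2.2.2.2.2
  positivity

/-- `0 ≤ h·2^P`. [folklore] -/
theorem hInt_nonneg (h : r.rowCheck.hOK = true) (hn : r.signsOK = true) : 0 ≤ r.hInt' := by
  have hp := hR_pos h hn
  rw [hR, toR] at hp
  by_contra hneg
  rw [not_le] at hneg
  have : (r.hInt' : ℝ) / 2 ^ r.P < 0 := div_neg_of_neg_of_pos (by exact_mod_cast hneg) (twoP_pos r)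
  linarith

/-- `0 ≤ c` as an integer. [folklore] -/
theorem c_nonneg : 0 ≤ r.c' := le_max_left _ _

/-- `0 ≤ c` (`Cert.hc`). [folklore] -/
theorem cR_nonneg : 0 ≤ r.cR := toR_nonneg c_nonneg

/-- `0 ≤ B` (`Cert.hB0`). [folklore] -/
theorem BR_nonneg (i j : Fin 8) : 0 ≤ r.BR i j := by
  refine toR_nonneg ?_
  rw [B', Tab.at_mk']
  exact DI.mag_nonneg _

/-- `0 ≤ E` (`Cert.hE0`). [folklore] -/
theorem ER_nonneg (hn : r.signsOK = true) (i k : Fin 8) : 0 ≤ r.ER i k :=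
  toR_nonneg ((nnOK_iff.mp hn).1 i k)

/-- `0 ≤ φ` (`Cert.hφ0`). [folklore] -/
theorem phiR_nonneg (hn : r.signsOK = true) (i : Fin 8) : 0 ≤ r.phiR i :=
  toR_nonneg ((nnOK_iff.mp hn).2.2.2.2.1 i)

/-! ### `I + h B E ≤ E` -/

/-- `Cert.hIE`. [folklore] -/
theorem hIE_sound (h : r.rowCheck.eOK = true) (i k : Fin 8) :
    (if i = k then (1 : ℝ) else 0) ≤ r.ER i k - r.hR * ∑ j, r.BR i j * r.ER j k := by
  have hz := (eOK_iff.mp h) i k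
  rw [sumZ_eq] at hz
  have hr : ((if i = k then one r.P * one r.P * one r.P else 0 : ℤ) : ℝ) +
      (r.hInt' : ℝ) * ∑ j, (r.B'.at i j : ℝ) * (r.Et.at j k : ℝ) ≤
        (r.Et.at i k : ℝ) * 2 ^ r.P * 2 ^ r.P := by
    have := (Int.cast_le (R := ℝ)).mpr hz
    push_cast at this
    simpa using this
  have hEt : ∀ a b, r.Et.at a b = r.E a b := fun a b => by rw [Et, Tab.at_mk']
  simp only [hEt] at hr
  have e1 : (((if i = k then one r.P * one r.P * one r.P else 0 : ℤ) : ℝ)) =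
      (if i = k then (1 : ℝ) else 0) * (2 ^ r.P) ^ 3 := by
    split_ifs
    · simp [one]; ring
    · simp
  have e2 : (r.hInt' : ℝ) * ∑ j, (r.B'.at i j : ℝ) * (r.E j k : ℝ) =
      (r.hR * ∑ j, r.BR i j * r.ER j k) * (2 ^ r.P) ^ 3 := by
    simp only [hR, BR, ER, toR]
    rw [Finset.mul_sum, Finset.mul_sum, Finset.sum_mul]
    refine Finset.sum_congr rfl fun j _ => ?_
    field_simp
  have e3 : (r.E i k : ℝ) * 2 ^ r.P * 2 ^ r.P = r.ER i k * (2 ^ r.P) ^ 3 := by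
    simp only [ER, toR]
    field_simp
  rw [e1, e2, e3, ← add_mul] at hr
  have := le_of_mul_le_mul_right hr (by positivity)
  linarith

/-! ### `η`, `η'` against the exponentials -/

/-- `c h ≤ ⌈c h⌉` in the real view: `cR * hR ≤ toR ch'`. [folklore] -/
theorem cR_mul_hR_le : r.cR * r.hR ≤ r.toR r.ch' := toR_mul_le _ _

/-- `⌊c h⌋ ≤ c h` in the real view. [folklore] -/
theorem toR_chlo_le : r.toR r.chlo' ≤ r.cR * r.hR := by
  simp only [toR, cR, hR, chlo']
  have h1 : ((r.c' * r.hInt' / one r.P : ℤ) : ℝ) * 2 ^ r.P ≤ (r.c' : ℝ) * r.hInt' := by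
    have := Int.ediv_mul_le (r.c' * r.hInt') (one_pos r.P).ne'
    have := (Int.cast_le (R := ℝ)).mpr this
    push_cast at this
    simpa [one] using this
  rw [div_mul_div_comm, div_le_div_iff₀ (twoP_pos r) (by positivity)]
  have hO := twoP_pos r
  nlinarith [hO]

/-- `e^{-ch} ≤ η` (`Cert.hη`). [folklore] -/
theorem eta_sound (h : r.rowCheck.hOK = true) (hn : r.signsOK = true) :
    exp (-(r.cR * r.hR)) ≤ r.etaR := by
  have hx : 0 ≤ r.cR * r.hR := mul_nonneg cR_nonneg (hR_pos h hn).le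
  have hchlo : 0 ≤ r.chlo' :=
    Int.ediv_nonneg (mul_nonneg c_nonneg (hInt_nonneg h hn)) (one_pos r.P).le
  have hden : 0 < one r.P + r.chlo' := by have := one_pos r.P; omega
  -- `η ≥ 2^P·2^P / (2^P + chlo)` as integers-rounded-up
  have h1 : ((one r.P * one r.P : ℤ) : ℝ) / ((one r.P + r.chlo' : ℤ) : ℝ) ≤ (r.eta' : ℝ) := by
    have := div_le_cdiv (a := one r.P * one r.P) hden
    simpa [eta'] using this
  have hO := twoP_pos r
  have hdenR : (0 : ℝ) < 2 ^ r.P + (r.chlo' : ℝ) := by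
    have : (0 : ℝ) ≤ (r.chlo' : ℝ) := by exact_mod_cast hchlo
    linarith
  -- real chain: e^{-x} ≤ 1/(1+x) ≤ 1/(1 + chlo/2^P) = 2^P/(2^P+chlo) ≤ η/2^P
  have h2 : exp (-(r.cR * r.hR)) ≤ 1 / (1 + r.cR * r.hR) := by
    rw [exp_neg, ← one_div]
    exact one_div_le_one_div_of_le (by linarith) (by linarith [add_one_le_exp (r.cR * r.hR)])
  have h3 : 1 / (1 + r.cR * r.hR) ≤ 1 / (1 + r.toR r.chlo') :=
    one_div_le_one_div_of_le (by have := toR_nonneg (r := r) hchlo; linarith)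
      (by linarith [toR_chlo_le (r := r)])
  have h4 : 1 / (1 + r.toR r.chlo') =
      (2 ^ r.P * 2 ^ r.P / (2 ^ r.P + (r.chlo' : ℝ))) / 2 ^ r.P := by
    simp only [toR]
    field_simp
  have h5 : (2 ^ r.P * 2 ^ r.P / (2 ^ r.P + (r.chlo' : ℝ))) / 2 ^ r.P ≤ r.etaR := by
    simp only [etaR, toR]
    refine div_le_div_of_nonneg_right ?_ hO.le
    push_cast [one] at h1
    exact h1
  linarith [h4.le, h4.ge]

/-- `e^{ch} ≤ η'` (`Cert.hη'`). [folklore] -/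
theorem etap_sound (h : r.rowCheck.hOK = true) (hn : r.signsOK = true)
    (hc : r.rowCheck.chOK = true) : exp (r.cR * r.hR) ≤ r.etapR := by
  rw [chOK_iff] at hc
  have hx : 0 ≤ r.cR * r.hR := mul_nonneg cR_nonneg (hR_pos h hn).le
  have hden : 0 < one r.P - r.ch' := by omega
  have h1 : ((one r.P * one r.P : ℤ) : ℝ) / ((one r.P - r.ch' : ℤ) : ℝ) ≤ (r.etap' : ℝ) := by
    have := div_le_cdiv (a := one r.P * one r.P) hden
    simpa [etap'] using this
  have hO := twoP_pos r
  have hchR : r.cR * r.hR ≤ r.toR r.ch' := cR_mul_hR_le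
  have hlt : r.toR r.ch' < 1 := by
    simp only [toR]
    rw [div_lt_one hO]
    have := (Int.cast_lt (R := ℝ)).mpr hc
    simpa [one] using this
  have hdenR : (0 : ℝ) < 2 ^ r.P - (r.ch' : ℝ) := by
    have := (Int.cast_lt (R := ℝ)).mpr hc
    simp [one] at this
    linarith
  have h1x : r.cR * r.hR < 1 := lt_of_le_of_lt hchR hlt
  -- e^{x} ≤ 1/(1-x) ≤ 1/(1 - ch/2^P) = 2^P/(2^P - ch) ≤ η'/2^P
  have h2 : exp (r.cR * r.hR) ≤ 1 / (1 - r.cR * r.hR) := by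
    rw [le_div_iff₀ (by linarith)]
    have hm : 1 - r.cR * r.hR ≤ exp (-(r.cR * r.hR)) := by
      linarith [add_one_le_exp (-(r.cR * r.hR))]
    calc exp (r.cR * r.hR) * (1 - r.cR * r.hR) ≤ exp (r.cR * r.hR) * exp (-(r.cR * r.hR)) :=
          mul_le_mul_of_nonneg_left hm (exp_pos _).le
      _ = 1 := by rw [← exp_add]; simp
  have h3 : 1 / (1 - r.cR * r.hR) ≤ 1 / (1 - r.toR r.ch') :=
    one_div_le_one_div_of_le (by linarith) (by linarith)
  have h4 : 1 / (1 - r.toR r.ch') = (2 ^ r.P * 2 ^ r.P / (2 ^ r.P - (r.ch' : ℝ))) / 2 ^ r.P := by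
    simp only [toR]
    field_simp
  have h5 : (2 ^ r.P * 2 ^ r.P / (2 ^ r.P - (r.ch' : ℝ))) / 2 ^ r.P ≤ r.etapR := by
    simp only [etapR, toR]
    refine div_le_div_of_nonneg_right ?_ hO.le
    push_cast [one] at h1
    exact h1
  linarith [h4.le, h4.ge]

end RowData

end RowCheck

end Summit.NavierStokesRegularity.FluidComputer
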